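import Mathlib
import Summits.ValiantsHypothesis.ValiantsHypothesis.Theorems.DivisionGapPerDivisionHardStubJssContractionA
import Summits.ValiantsHypothesis.ValiantsHypothesis.Theorems.DivisionGapPerDivisionHardStubJssContractionB

/-!
# Crux `DivisionGap.PerDivisionHard` (stmt-ValiantsHypothesis-5065), line `pair-descent-jss-endpoint` —
stub `stub_jssContraction` (part C, the registered stub): a monomial cofactor helps a monotone
circuit at most polynomially

**Jukna–Seiwert–Sergeev contraction** (JuknaSeiwertSergeev2022, Lemma 2; Jukna, *Tropical Circuit
Complexity* 2023, Lemma 6.16 with Claims 6.17–6.18 and Remark 6.19 for the arithmetic semiring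
`ℝ≥0`), in the tree's fan-in-two weighted model `complexity` over `ℝ≥0` and RAW polynomial form:

`stub_jssContraction : ∃ κ, ∀ n f u, L(f) ≤ ((n + 2) (L(x^u · f) + 2))^κ`  (`κ = 4`).

Proof.  Let `P` be a size-minimal fan-in-two circuit for `g = x^u · f` (`f ≠ 0`), `s = |P|`,
`T = s + 1`.  Replace old gate `i` by the block of part B (length `K = kSize σ T`) whose LAST
gate computes `contract(value of gate i)` (part A): the two monomial blocks produce the
correction monomials `x^{δ₀}, x^{δ₁}` (`δⱼ = gcdVec(operand j) - gcdVec(gate)`, entries `< 2^T`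
by the degree bound of part A), two product gates multiply them onto the contracted operands (old
references `gate j` re-indexed to `gate (K j + K - 1)`, variables become `1 = contract (X v)`),
and the last gate re-adds (`contract_add_smul`) resp. multiplies (`contract_mul`) —
`gateValues_block`, `exists_contracted_gates`.  Finally `contract g = contract f`
(`contract_monomial_mul`) and `f = x^{gcdVec f} · contract f`, so one more monomial block and one
product gate compute `f`; the size is `K s + mSize + 1 ≤ ((n+2)(s+2))^4` (`size_le_pow_four`).
No definitions in this file (the layout is part B, the algebra part A).
-/

noncomputable section

-- `Summit.ValiantsHypothesis.ValiantsHypothesis.…` is the tree's mandated single-conjunct layout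
-- (Sub = Summit), so the duplicated namespace component is intended.
set_option linter.dupNamespace false

namespace Summit.ValiantsHypothesis.ValiantsHypothesis.Theorems.DivisionGapPerDivisionHard

open MvPolynomial Literature.Computability.AlgebraicComplexity ArithCircuit
open scoped NNReal

namespace JssContraction

variable {σ : Type*} [Fintype σ]

/-! ### Agreement of old and new value lists

Two value lists `vals` (old) and `w` (new) AGREE when `w` carries `contract` of the old values at
the positions `kSize · j + kPred` (junk `0 = contract 0` beyond):
`∀ j, w.getD (kSize σ T * j + kPred σ T) 0 = contract (vals.getD j 0)`.  Kept inline (no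
definition). -/

/-- Re-indexed operands read contracted old values off an agreeing value list. [folklore] -/
theorem eval_ref {T : ℕ} {vals w : List (MvPolynomial σ ℝ≥0)}
    (hA : ∀ j, w.getD (kSize σ T * j + kPred σ T) 0 = contract (vals.getD j 0))
    (u : Operand ℝ≥0 σ) : (ref T u).eval w = contract (u.eval vals) := by
  cases u with
  | var v => simp [ref, Operand.eval]
  | const c => simp [ref, Operand.eval]
  | gate j => exact hA j

/-- Appending at most `kPred` values (not reaching the next agreed position) keeps the agreement.
[folklore] -/
theorem agree_append {T : ℕ} {vals w : List (MvPolynomial σ ℝ≥0)}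
    (hA : ∀ j, w.getD (kSize σ T * j + kPred σ T) 0 = contract (vals.getD j 0))
    (hw : w.length = kSize σ T * vals.length) (L : List (MvPolynomial σ ℝ≥0))
    (hL : L.length ≤ kPred σ T) :
    ∀ j, (w ++ L).getD (kSize σ T * j + kPred σ T) 0 = contract (vals.getD j 0) := by
  intro j
  by_cases hj : kSize σ T * j + kPred σ T < w.length
  · rw [List.getD_append _ _ _ _ hj]
    exact hA j
  · have hij : vals.length ≤ j := by
      rw [hw] at hj
      exact not_lt.mp fun h => hj ((block_index_lt_iff (kPred σ T) vals.length j).mpr h)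
    have hmul : kSize σ T * vals.length ≤ kSize σ T * j := Nat.mul_le_mul_left _ hij
    rw [List.getD_eq_default _ _ hij, contract_zero,
      List.getD_eq_default _ _ (by rw [List.length_append]; omega)]

/-! ### Semantics of one block -/

/-- **The last gate of a block computes the contraction of the old gate's value**, given the two
corrected contracted operands at positions `base + 2 mSize`, `base + 2 mSize + 1` of an agreeing
value list (part A: `contract_add_smul`, `contract_smul`, `contract_mul`). [folklore] -/
theorem eval_lastGate {T base : ℕ} {vals W : List (MvPolynomial σ ℝ≥0)} {g : Gate ℝ≥0 σ}
    (hA : ∀ j, W.getD (kSize σ T * j + kPred σ T) 0 = contract (vals.getD j 0)) (hg : g.fanIn ≤ 2)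
    (h0 : W.getD (base + 2 * mSize σ T) 0 =
      monomial (gcdVec ((opd g 0).eval vals) - gcdVec (g.eval vals)) 1 *
        contract ((opd g 0).eval vals))
    (h1 : W.getD (base + 2 * mSize σ T + 1) 0 =
      monomial (gcdVec ((opd g 1).eval vals) - gcdVec (g.eval vals)) 1 *
        contract ((opd g 1).eval vals)) :
    (lastGate T base g).eval W = contract (g.eval vals) := by
  cases g with
  | sum args =>
    rcases args with _ | ⟨⟨c, u⟩, _ | ⟨⟨d, u'⟩, _ | ⟨e, rest⟩⟩⟩
    · simp [lastGate, Gate.eval]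
    · simp [lastGate, Gate.eval, eval_ref hA, contract_smul]
    · have hge : (Gate.sum [(c, u), (d, u')]).eval vals = c • u.eval vals + d • u'.eval vals := by
        simp [Gate.eval]
      have hl : (lastGate T base (Gate.sum [(c, u), (d, u')])).eval W =
          c • W.getD (base + 2 * mSize σ T) 0 + d • W.getD (base + 2 * mSize σ T + 1) 0 := by
        simp [lastGate, Gate.eval]
      rw [hl, h0, h1, hge, contract_add_smul]
      simp [opd, Gate.args]
    · exfalso
      simp [Gate.fanIn, Gate.args] at hg
  | prod args =>
    rcases args with _ | ⟨u, _ | ⟨u', _ | ⟨u'', rest⟩⟩⟩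
    · simp [lastGate, Gate.eval]
    · simp [lastGate, Gate.eval, eval_ref hA]
    · simp [lastGate, Gate.eval, eval_ref hA, contract_mul]
    · exfalso
      simp [Gate.fanIn, Gate.args] at hg

/-- **One block**: appended to a gate list `G` whose values agree with the old values `vals`, the
block of an old gate `g` (with its two correction exponents) appends `kPred` values and then
`contract (g.eval vals)` — provided all gcd vectors of operand values have entries `< 2^T` (so
that the monomial blocks are correct). [folklore] -/
theorem gateValues_block (T : ℕ) (G : List (Gate ℝ≥0 σ)) (vals : List (MvPolynomial σ ℝ≥0))
    (g : Gate ℝ≥0 σ)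
    (hA : ∀ j, (gateValues G).getD (kSize σ T * j + kPred σ T) 0 = contract (vals.getD j 0))
    (hlen : G.length = kSize σ T * vals.length)
    (hdeg : ∀ (u : Operand ℝ≥0 σ) (v : σ), gcdVec (u.eval vals) v < 2 ^ T) (hg : g.fanIn ≤ 2) :
    ∃ mid : List (MvPolynomial σ ℝ≥0), mid.length = kPred σ T ∧
      gateValues (G ++ block T G.length
          (gcdVec ((opd g 0).eval vals) - gcdVec (g.eval vals))
          (gcdVec ((opd g 1).eval vals) - gcdVec (g.eval vals)) g) =
        gateValues G ++ mid ++ [contract (g.eval vals)] := by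
  set δ₀ := gcdVec ((opd g 0).eval vals) - gcdVec (g.eval vals) with hδ₀
  set δ₁ := gcdVec ((opd g 1).eval vals) - gcdVec (g.eval vals) with hδ₁
  set w := gateValues G with hw
  have hwG : w.length = G.length := gateValues_length G
  have hwlen : w.length = kSize σ T * vals.length := by rw [hwG, hlen]
  set V1 := gateValues (monBlock ℝ≥0 T δ₀) with hV1
  set V2 := gateValues (monBlock ℝ≥0 T δ₁) with hV2
  have hV1len : V1.length = mSize σ T := by rw [hV1, gateValues_length, length_monBlock]
  have hV2len : V2.length = mSize σ T := by rw [hV2, gateValues_length, length_monBlock]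
  have hMS : mSize σ T = mPred σ T + 1 := rfl
  have hδ₀T : ∀ v : σ, δ₀ v < 2 ^ T := fun v => by
    rw [hδ₀, Finsupp.tsub_apply]
    exact lt_of_le_of_lt (Nat.sub_le _ _) (hdeg _ v)
  have hδ₁T : ∀ v : σ, δ₁ v < 2 ^ T := fun v => by
    rw [hδ₁, Finsupp.tsub_apply]
    exact lt_of_le_of_lt (Nat.sub_le _ _) (hdeg _ v)
  have hm1 : V1.getD (mPred σ T) 0 = monomial δ₀ 1 := getD_gateValues_monBlock hδ₀T
  have hm2 : V2.getD (mPred σ T) 0 = monomial δ₁ 1 := getD_gateValues_monBlock hδ₁T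
  -- splicing the two monomial blocks
  have e1 : gateValues (G ++ (monBlock ℝ≥0 T δ₀).map (Gate.shift G.length)) = w ++ V1 :=
    gateValues_append_shift _ _
  have e2 : gateValues (G ++ (monBlock ℝ≥0 T δ₀).map (Gate.shift G.length) ++
      (monBlock ℝ≥0 T δ₁).map (Gate.shift (G.length + mSize σ T))) = w ++ V1 ++ V2 := by
    have h := gateValues_append_shift
      (G ++ (monBlock ℝ≥0 T δ₀).map (Gate.shift G.length)) (monBlock ℝ≥0 T δ₁)
    rw [List.length_append, List.length_map, length_monBlock, e1] at h
    exact h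
  -- the two product gates
  set x1 := monomial δ₀ (1 : ℝ≥0) * contract ((opd g 0).eval vals) with hx1
  set x2 := monomial δ₁ (1 : ℝ≥0) * contract ((opd g 1).eval vals) with hx2
  have hA0 := agree_append hA hwlen (V1 ++ V2) (by simp [hV1len, hV2len, kPred]; omega)
  have hA1 := agree_append hA hwlen (V1 ++ (V2 ++ [x1])) (by simp [hV1len, hV2len, kPred]; omega)
  have hA2 := agree_append hA hwlen (V1 ++ V2 ++ [x1, x2]) (by simp [hV1len, hV2len, kPred]; omega)
  have hv1 : (Gate.prod [.gate (G.length + mPred σ T), ref T (opd g 0)]).eval (w ++ V1 ++ V2) =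
      x1 := by
    simp only [Gate.eval, List.map_cons, List.map_nil, List.prod_cons, List.prod_nil, mul_one]
    rw [List.append_assoc, eval_ref hA0, Operand.eval_gate, ← hwG,
      List.getD_append_right _ _ _ _ (Nat.le_add_right _ _), Nat.add_sub_cancel_left,
      List.getD_append _ _ _ _ (by rw [hV1len, hMS]; exact Nat.lt_succ_self _), hm1]
  have hv2 : (Gate.prod [.gate (G.length + mSize σ T + mPred σ T), ref T (opd g 1)]).eval
      (w ++ V1 ++ V2 ++ [x1]) = x2 := by
    simp only [Gate.eval, List.map_cons, List.map_nil, List.prod_cons, List.prod_nil, mul_one]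
    rw [List.append_assoc, List.append_assoc, eval_ref hA1, Operand.eval_gate,
      ← hwG, Nat.add_assoc, List.getD_append_right _ _ _ _ (Nat.le_add_right _ _),
      Nat.add_sub_cancel_left, ← hV1len,
      List.getD_append_right _ _ _ _ (Nat.le_add_right _ _), Nat.add_sub_cancel_left,
      List.getD_append _ _ _ _ (by rw [hV2len, hMS]; exact Nat.lt_succ_self _), hm2]
  have h12len : (V1 ++ V2).length = 2 * mSize σ T := by
    rw [List.length_append, hV1len, hV2len]; ring
  have hv3 : (lastGate T G.length g).eval (w ++ V1 ++ V2 ++ [x1] ++ [x2]) =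
      contract (g.eval vals) := by
    have hW : w ++ V1 ++ V2 ++ [x1] ++ [x2] = w ++ ((V1 ++ V2) ++ [x1, x2]) := by simp
    rw [hW]
    refine eval_lastGate hA2 hg ?_ ?_
    · rw [← hwG, List.getD_append_right _ _ _ _ (Nat.le_add_right _ _), Nat.add_sub_cancel_left,
        List.getD_append_right _ _ _ _ h12len.le, h12len, Nat.sub_self, List.getD_cons_zero]
    · rw [← hwG, Nat.add_assoc, List.getD_append_right _ _ _ _ (Nat.le_add_right _ _),
        Nat.add_sub_cancel_left, List.getD_append_right _ _ _ _ (by omega), h12len,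
        Nat.add_sub_cancel_left, List.getD_cons_succ, List.getD_cons_zero]
  -- assembling the fold
  have hsplit : G ++ block T G.length δ₀ δ₁ g =
      G ++ (monBlock ℝ≥0 T δ₀).map (Gate.shift G.length) ++
        (monBlock ℝ≥0 T δ₁).map (Gate.shift (G.length + mSize σ T)) ++
        [Gate.prod [.gate (G.length + mPred σ T), ref T (opd g 0)]] ++
        [Gate.prod [.gate (G.length + mSize σ T + mPred σ T), ref T (opd g 1)]] ++
        [lastGate T G.length g] := by
    simp [block]
  refine ⟨V1 ++ V2 ++ [x1, x2], by simp [hV1len, hV2len, kPred]; ring, ?_⟩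
  rw [hsplit, gateValues_append_singleton, gateValues_append_singleton,
    gateValues_append_singleton, e2, hv1, hv2, hv3]
  simp

/-! ### The whole new gate list -/

/-- **The contracted gate list**: a fan-in-two gate list `gs` of length `≤ T` has a fan-in-two
companion `G` of length `kSize · |gs|` carrying `contract` of every old gate value at the
positions `kSize · j + kPred` (built block by block, threading the old values;
Jukna 2023, Claims 6.17–6.18). [folklore] -/
theorem exists_contracted_gates (T : ℕ) (gs : List (Gate ℝ≥0 σ)) (h2 : ∀ g ∈ gs, g.fanIn ≤ 2)
    (hT : gs.length ≤ T) :
    ∃ G : List (Gate ℝ≥0 σ), G.length = kSize σ T * gs.length ∧ (∀ g ∈ G, g.fanIn ≤ 2) ∧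
      ∀ j, (gateValues G).getD (kSize σ T * j + kPred σ T) 0 =
        contract ((gateValues gs).getD j 0) := by
  induction gs using List.reverseRecOn with
  | nil =>
    refine ⟨[], by simp, by simp, fun j => ?_⟩
    simp [gateValues]
  | append_singleton gs g ih =>
    have h2' : ∀ g' ∈ gs, g'.fanIn ≤ 2 := fun g' hg' => h2 g' (List.mem_append_left _ hg')
    have hg : g.fanIn ≤ 2 := h2 g (by simp)
    have hT' : gs.length < T := by
      rw [List.length_append, List.length_singleton] at hT; omega
    obtain ⟨G, hGlen, hG2, hA⟩ := ih h2' hT'.le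
    have hdeg : ∀ (u : Operand ℝ≥0 σ) (v : σ), gcdVec (u.eval (gateValues gs)) v < 2 ^ T :=
      fun u v => lt_of_le_of_lt
        ((gcdVec_apply_le_totalDegree _ v).trans (totalDegree_operand_eval_le gs h2' u))
        (Nat.pow_lt_pow_right (by norm_num) hT')
    have hvlen : (gateValues gs).length = gs.length := gateValues_length gs
    obtain ⟨mid, hmid, hvals⟩ :=
      gateValues_block T G (gateValues gs) g hA (by rw [hGlen, hvlen]) hdeg hg
    refine ⟨G ++ block T G.length
        (gcdVec ((opd g 0).eval (gateValues gs)) - gcdVec (g.eval (gateValues gs)))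
        (gcdVec ((opd g 1).eval (gateValues gs)) - gcdVec (g.eval (gateValues gs))) g,
      ?_, ?_, ?_⟩
    · rw [List.length_append, length_block, hGlen, List.length_append, List.length_singleton]
      ring
    · intro g' hg'
      rcases List.mem_append.mp hg' with h | h
      · exact hG2 g' h
      · exact fanIn_of_mem_block h
    rw [hvals, gateValues_append_singleton]
    set w := gateValues G with hw
    have hwlen : w.length = kSize σ T * gs.length := by rw [hw, gateValues_length, hGlen]
    intro j
    rcases Nat.lt_trichotomy j gs.length with hj | rfl | hj
    · have hpos : kSize σ T * j + kPred σ T < w.length := by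
        rw [hwlen]; exact (block_index_lt_iff (kPred σ T) gs.length j).mpr hj
      rw [List.append_assoc, List.getD_append _ _ _ _ hpos, List.getD_append _ _ _ _ (hvlen ▸ hj)]
      exact hA j
    · have hpos : (w ++ mid).length = kSize σ T * gs.length + kPred σ T := by
        rw [List.length_append, hwlen, hmid]
      rw [List.getD_append_right _ _ _ _ hpos.le, hpos, Nat.sub_self, List.getD_cons_zero,
        List.getD_append_right _ _ _ _ hvlen.le, hvlen, Nat.sub_self, List.getD_cons_zero]
    · have hmul : kSize σ T * gs.length + kSize σ T ≤ kSize σ T * j := by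
        rw [← mul_add_one]; exact Nat.mul_le_mul_left _ hj
      have hK : kSize σ T = kPred σ T + 1 := rfl
      have hR : (gateValues gs ++ [g.eval (gateValues gs)]).getD j 0 = 0 :=
        List.getD_eq_default _ _ (by rw [List.length_append, List.length_singleton, hvlen]; omega)
      have hL : (w ++ mid ++ [contract (g.eval (gateValues gs))]).getD
          (kSize σ T * j + kPred σ T) 0 = 0 :=
        List.getD_eq_default _ _ (by
          rw [List.length_append, List.length_append, List.length_singleton, hwlen, hmid]; omega)
      rw [hL, hR, contract_zero]

/-! ### The contracted circuit and the size arithmetic -/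

/-- **The contracted circuit**: for a fan-in-two `P` of size `s < T` and an exponent vector `e` with
entries `< 2^T` there is a fan-in-two circuit of size `kSize · s + mSize + 1` computing
`x^e · contract(P.eval)` (all blocks, one more monomial block, one product gate). [folklore] -/
theorem exists_circuit_monomial_mul_contract {T : ℕ} {P : ArithCircuit ℝ≥0 σ} {e : σ →₀ ℕ}
    (h2 : P.IsFanInTwo) (hT : P.size < T) (he : ∀ v, e v < 2 ^ T) :
    ∃ Q : ArithCircuit ℝ≥0 σ, Q.IsFanInTwo ∧ Q.size = kSize σ T * P.size + mSize σ T + 1 ∧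
      Q.eval = monomial e 1 * contract P.eval := by
  obtain ⟨G, hGlen, hG2, hA⟩ := exists_contracted_gates T P.gates h2 hT.le
  have hGs : G.length = kSize σ T * P.size := hGlen
  let Q : ArithCircuit ℝ≥0 σ :=
    { gates := G ++ (monBlock ℝ≥0 T e).map (Gate.shift G.length) ++
        [Gate.prod [.gate (G.length + mPred σ T), ref T P.output]]
      output := .gate (G.length + mSize σ T) }
  refine ⟨Q, ?_, ?_, ?_⟩
  · intro g hg
    simp only [Q, List.mem_append, List.mem_map, List.mem_singleton] at hg
    rcases hg with (hg | ⟨g₀, h₀, rfl⟩) | rfl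
    · exact hG2 g hg
    · have hshift : (g₀.shift G.length).fanIn = g₀.fanIn := by
        cases g₀ <;> simp [Gate.shift, Gate.fanIn, Gate.args]
      rw [hshift]; exact fanIn_of_mem_monBlock h₀
    · simp [Gate.fanIn, Gate.args]
  · simp [Q, size, hGs, add_assoc]
  have hwlen : (gateValues G).length = G.length := gateValues_length G
  have hVlen : (gateValues (monBlock ℝ≥0 T e)).length = mSize σ T := by
    rw [gateValues_length, length_monBlock]
  have hA' := agree_append hA (by rw [hwlen, hGs, gateValues_length, size])
    (gateValues (monBlock ℝ≥0 T e)) (by rw [hVlen, kPred]; omega)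
  have hlen2 : (gateValues G ++ gateValues (monBlock ℝ≥0 T e)).length = G.length + mSize σ T := by
    rw [List.length_append, hwlen, hVlen]
  show (Operand.gate (G.length + mSize σ T) : Operand ℝ≥0 σ).eval
    (gateValues (G ++ (monBlock ℝ≥0 T e).map (Gate.shift G.length) ++ _)) = _
  rw [gateValues_append_singleton, gateValues_append_shift, Operand.eval_gate,
    List.getD_append_right _ _ _ _ hlen2.le, hlen2, Nat.sub_self, List.getD_cons_zero]
  simp only [Gate.eval, List.map_cons, List.map_nil, List.prod_cons, List.prod_nil, mul_one]
  rw [eval_ref hA', Operand.eval_gate, ← hwlen,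
    List.getD_append_right _ _ _ _ (Nat.le_add_right _ _), Nat.add_sub_cancel_left,
    getD_gateValues_monBlock he]
  rfl

/-- The size arithmetic: `2X³ + X² + 5X + 2 ≤ X⁴` for `X ≥ 4`. [folklore] -/
theorem poly_le_pow_four {X : ℕ} (hX : 4 ≤ X) : 2 * X ^ 3 + X ^ 2 + 5 * X + 2 ≤ X ^ 4 := by
  have h1 : X ^ 4 = X * X ^ 3 := by ring
  have h2 : X ^ 3 = X * X ^ 2 := by ring
  have h3 : X ^ 2 = X * X := by ring
  have h4 := Nat.mul_le_mul_right (X ^ 3) hX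
  have h5 := Nat.mul_le_mul_right (X ^ 2) hX
  have h6 := Nat.mul_le_mul_right X hX
  omega

/-- **Size bound**: with `T = s + 1` and `σ = Fin n × Fin n`,
`kSize · s + mSize + 1 ≤ ((n + 2)(s + 2))^4`. [folklore] -/
theorem size_le_pow_four (n s : ℕ) :
    kSize (Fin n × Fin n) (s + 1) * s + mSize (Fin n × Fin n) (s + 1) + 1 ≤
      ((n + 2) * (s + 2)) ^ 4 := by
  set X := (n + 2) * (s + 2) with hX
  have hX4 : 4 ≤ X := by
    have h : 2 * 2 ≤ (n + 2) * (s + 2) := Nat.mul_le_mul (by omega) (by omega)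
    rw [hX]; omega
  have hsX : s ≤ X := by
    have h : 1 * s ≤ (n + 2) * (s + 2) := Nat.mul_le_mul (by omega) (by omega)
    rw [hX]; omega
  have hm : mPred (Fin n × Fin n) (s + 1) ≤ X ^ 2 := by
    simp only [mPred, Fintype.card_prod, Fintype.card_fin]
    have hsq : 2 * (s + 1) + 1 ≤ (s + 2) * (s + 2) := by
      have : (s + 2) * (s + 2) = s * s + 4 * s + 4 := by ring
      omega
    calc n * n * (2 * (s + 1) + 1) ≤ (n + 2) * (n + 2) * ((s + 2) * (s + 2)) :=
          Nat.mul_le_mul (Nat.mul_le_mul (by omega) (by omega)) hsq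
      _ = X ^ 2 := by rw [hX]; ring
  have hk : kSize (Fin n × Fin n) (s + 1) = 2 * mPred (Fin n × Fin n) (s + 1) + 5 := by
    simp only [kSize, kPred, mSize]; ring
  have hms : mSize (Fin n × Fin n) (s + 1) = mPred (Fin n × Fin n) (s + 1) + 1 := rfl
  rw [hk, hms]
  set m := mPred (Fin n × Fin n) (s + 1)
  calc (2 * m + 5) * s + (m + 1) + 1 ≤ (2 * X ^ 2 + 5) * X + (X ^ 2 + 1) + 1 := by
        gcongr
    _ ≤ 2 * X ^ 3 + X ^ 2 + 5 * X + 2 := by ring_nf; omega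
    _ ≤ X ^ 4 := poly_le_pow_four hX4

end JssContraction

open JssContraction in
/-- **stub_jssContraction (the Jukna–Seiwert–Sergeev endpoint; JuknaSeiwertSergeev2022 Lemma 2 =
Jukna 2023, Lemma 6.16 with Claims 6.17–6.18, Remark 6.19, in the tree's weighted fan-in-two
monotone model over `ℝ≥0`).**  A monomial cofactor helps at most polynomially: if `x^u · f` has a
fan-in-two circuit of size `s` over `ℝ≥0` in the `n²` variables `x_ij`, then `f` has one of size
`≤ ((n + 2)(s + 2))^4` — carry the contraction `[g] = g / x^{gcdVec g}` gate by gate (sum gates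
re-multiply the contracted operands by `2^s`-bounded correction monomials produced by repeated
squaring; product gates multiply), and finish with `f = x^{gcdVec f} · [x^u f]`.  RAW polynomial
form with `κ = 4`; `f = 0`, variables and constants are free. [cite: JuknaSeiwertSergeev2022, Lemma 2] -/
theorem stub_jssContraction :
    ∃ κ : ℕ, ∀ (n : ℕ) (f : MvPolynomial (Fin n × Fin n) ℝ≥0) (u : (Fin n × Fin n) →₀ ℕ),
      complexity f ≤ ((n + 2) * (complexity (monomial u (1 : ℝ≥0) * f) + 2)) ^ κ := by
  refine ⟨4, fun n f u => ?_⟩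
  by_cases hf : f = 0
  · rw [hf, ← C_0, complexity_C_holds]
    exact Nat.zero_le _
  obtain ⟨P, h2, hP, hs⟩ := exists_computes_size_eq_complexity (monomial u (1 : ℝ≥0) * f)
  rw [← hs]
  -- exponents of `gcdVec f` are `2^s`-bounded
  have hPe : P.eval = monomial u 1 * f := hP
  have he : ∀ v, gcdVec f v < 2 ^ (P.size + 1) := fun v => by
    refine lt_of_le_of_lt ((gcdVec_apply_le_totalDegree_monomial_mul u f v).trans ?_)
      (Nat.pow_lt_pow_right (by norm_num) (Nat.lt_succ_self _))
    rw [← hPe]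
    exact totalDegree_operand_eval_le P.gates h2 P.output
  -- the contracted circuit computes `f`
  obtain ⟨Q, hQ2, hQs, hQe⟩ :=
    exists_circuit_monomial_mul_contract h2 (Nat.lt_succ_self P.size) he
  have hQ : Q.Computes f := by
    show Q.eval = f
    rw [hQe, hPe, contract_monomial_mul, monomial_gcdVec_mul_contract]
  refine (complexity_le_size hQ2 hQ).trans ?_
  rw [hQs]
  exact size_le_pow_four n P.size

end Summit.ValiantsHypothesis.ValiantsHypothesis.Theorems.DivisionGapPerDivisionHard

end
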